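import Mathlib
import Summits.NavierStokesRegularity.NavierStokesRegularity.Theses.EulerZoomLiouville
import Summits.NavierStokesRegularity.NavierStokesRegularity.Theorems.EulerZoomLiouvillePowerGaugeEulerLiouvilleBirthDefsThree
import Summits.NavierStokesRegularity.NavierStokesRegularity.Theorems.EulerZoomLiouvillePowerGaugeEulerLiouvilleWeakTransportFieldData
import Summits.NavierStokesRegularity.NavierStokesRegularity.Theorems.EulerZoomLiouvillePowerGaugeEulerLiouvilleWeakBernoulliClock
import Summits.NavierStokesRegularity.NavierStokesRegularity.Theorems.EulerZoomLiouvillePowerGaugeEulerLiouvilleWeakChainRule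
import Summits.NavierStokesRegularity.NavierStokesRegularity.Theorems.EulerZoomLiouvillePowerGaugeEulerLiouvilleWeakSupportLaw
import Literature.Analysis.FluidPDE.TaoEnstrophyLocalisation
import Literature.Analysis.FluidPDE.VectorCalculus

/-!
v117 IMPORT SWITCH (REV10, ns-idea-11 g12, 2026-08-29T14:1xZ; asked by LEAD 19832 g16 FINAL): the eight local verbatim copies of birth predicates
(`E3`, `InClass`, `IsExactlySelfSimilar`, `IsExtremalProfile`, `IsHomogeneousProfile`, `IsPowerSpreadProfile`, `IsClassicalConcentrating`, `IsWeakConfinedCurl`) are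
DELETED; the file IMPORTS `Theorems/…BirthDefsThree.lean` (birth v117 5e45166c439e moved the 52 binder predicates there) and OPENS
`…Theorems.PowerGaugeEulerLiouville.Birth`, so every predicate name denotes the LEAD's own declaration and future alternatives of `IsWeakConfinedCurl`
propagate with no copy sync; target `Sig.stub_selfSimilarWeakRest` unchanged (= birth v117 verbatim, normalised-whitespace checked); L-stubs texts UNCHANGED.
# Line `weak_lagrangian` — ns-idea-11 g9 (lens «complete» = program-completion), crux `PowerGaugeEulerLiouville` (stmt-NavierStokesRegularity-19832)

TARGET BY NAME: the open birth stub `Sig.stub_selfSimilarWeakRest` (birth v107, sha16 7637547de0825dbf — target text unchanged since v101 7f25262060e18363; `IsWeakConfinedCurl` = v107 four-sense text; earlier v103 text with alt 3; since v99 the target carries `¬ IsWeakConfinedCurl ρ V` — three weak sub-strata killed by v103, ns-ezl-w1 g8 p690763 / p691156 / p692391, Eulerian, no flow) — the GENUINELY WEAK exactly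
self-similar stratum (`V ∉ C²`, `V ∈ W^{1,2}_loc`, `P ∈ L^{3/2}_loc`).  COPY DISCIPLINE: `E3`, `InClass`, `IsExactlySelfSimilar`, `IsExtremalProfile`,
`IsHomogeneousProfile`, `IsPowerSpreadProfile`, `IsClassicalConcentrating`, `IsWeakConfinedCurl` and `Sig.stub_selfSimilarWeakRest` below are VERBATIM copies of birth v107
(identity-checked by normalised-whitespace diff against the tree file at filing time).

PROGRAMME COMPLETED (DiPerna–Lions 1989 / Le Bris–Lions 2004 / Ambrosio–Crippa 2008, author-named gaps of width seat ns-ezl-w1 g7 HANDOFF (M1)/(F2)/(M2)):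
every kill of the `C²` lattice runs a positive-measure blob through a CLOCK along backward similarity orbits `Y′ = −W(Y)`, `W = γy + V`, and uses Kelvin
(«a.e. vortical backward orbit …»); the weak stratum has no flow.  The input certificate is IN THE TREE: `WeakRenormalized.dipernaLionsData_of_selfSimilar`
(p687484: `W ∈ W^{1,2}_loc`, `DW = γ·id + G`, `div W = 3γ`, `V/(1+|y|) ∈ L²` = (DL1)–(DL3)).  This skeleton supplies the LAGRANGIAN PORTRAIT of the weak
member as four bricks and isolates the wall:

* `stub_backwardFlow`      (M1, PORT — Ambrosio–Crippa 2008 Thm 26 = DiPerna–Lions 1989 Thm III.1/III.2): the regular Lagrangian flow `Ψ` of `−W`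
                             (a.e. label an absolutely continuous integral curve, semigroup a.e., EXACT Jacobian law `(Ψ_σ)_# vol = e^{3γσ} vol`);
* `stub_chainRule`         (F2, FILLED in REV3 — ns-ezl-w1 g8 p694614 `…Theorems.PowerGaugeEulerLiouville.WeakLagrangian.chainRule`, by name; «Lagrangian = Eulerian»
                             for Sobolev observables, Ambrosio–Crippa 2008 §3/Thm 24 pattern): every `f ∈ W^{1,1}_loc` with `∇f ∈ L^{3/2}_loc` obeys
                             `f(Ψ_σ y) = f(y) − ∫₀^σ ∇f·W ∘ Ψ_s y ds` for a.e. label;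
* `stub_bernoulliClock`    (FILLED in REV2 — ns-ezl-w1 g8 p692885 `…Theorems.PowerGaugeEulerLiouville.WeakLagrangian.bernoulliClock`, by name): the similarity
                             Bernoulli function `ℋ = P + ½|W|² − ½γ(1−γ)|y|²` is NON-DECREASING along a.e. backward orbit — the CLOCK of the needle theory, weak class;
* `stub_lagrangianKelvin`  (M2, RESEARCH — ingredient in print: Le Bris–Lions 2004 = Ambrosio–Crippa 2008 Thm 41, the derivative-in-measure `D` of the RLF is the
                             Lagrangian flow of the tangent system; NOT in print: the CAUCHY FORMULA `curl V(Ψ_σ y) = e^{(1+γ)σ} D_σ(y) curl V(y)` for the `L²_loc`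
                             vorticity of a `W^{1,2}_loc` similarity profile = uniqueness/Lagrangianity of `L²` distributional solutions of the vector advection
                             equation with `W^{1,2}` velocity, stretching coefficient `DW ∈ L²` unbounded);
* `stub_supportLaw`        (REV2; FILLED in REV4 from ns-ezl-w1 g8 p695120 `…Theorems.PowerGaugeEulerLiouville.WeakLagrangian.supportLaw`, by name — CHAE'S SUPPORT
                             LAW PORTED TO THE WEAK CLASS; the `p → 0` endpoint of Chae 2007 Thm 1.1 = [corpus:paper:arxiv-math_0601661
                             p.3 Cor. 1], doi:10.1007/s00220-007-0249-8, whose classical proof needs a Lipschitz back-to-labels map): portrait + `vol{curl V ≠ 0} < ∞` ⇒ trivial,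
                             for EVERY `ρ ∈ (0,½]` — the Cauchy formula propagates `curl V(y) = 0` forward along `Ψ` (no invertibility of `D` needed), so
                             `Ψ_σ⁻¹{curl ≠ 0} ⊆ {curl ≠ 0}` a.e., and the exact Jacobian law gives `e^{3γσ}·vol ≤ vol`, hence `vol = 0`, `G` a.e. symmetric,
                             weak Liouville (`ae_eq_zero_of_symm_traceFree_of_growth`).  THIS IS THE WIDTH of the line: the finite-volume-vorticity-support stratum,
                             Eulerian-inaccessible, and at `ρ = ½` the first kill of any weak profile (ns-ezl-w1 HANDOFF-g8: «compactly supported weak profiles at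
                             ρ = ½ are NOT excluded» — they are, given M1 + M2);
* `stub_weakNeedleFace`    (OPEN — THE SAME WALL as `Sig.stub_selfSimilarC2Needle`, stated in a.e./Lagrangian binders, NARROWED in REV2 by `vol{curl V ≠ 0} = ∞`):
                             weak-rest hypotheses + the Lagrangian portrait (flow, chain rule, clock, Kelvin) + infinite-volume vorticity support ⇒ trivial.

Composition `selfSimilarWeakRest_of : (six stubs) → Sig.stub_selfSimilarWeakRest` is kernel-checked (no placeholder outside the `stub_*`; REV2: `stub_bernoulliClock` is
FILLED from the tree, so the placeholders were S1, S2, S4, S5, S6 = 5; REV3: `stub_chainRule` is FILLED too (p694614), placeholders S1, S4, S5, S6 = 4; REV4: `stub_supportLaw` is FILLED (p695120), placeholders S1, S4, S5 = 3); the DiPerna–Lions data `G` are obtained INSIDE the composition from the tree theorem by name, and the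
composition CASE-SPLITS on `vol{curlCLM ∘ G ≠ 0}` (finite ⇒ `stub_supportLaw`, infinite ⇒ the face).  FILES ONLY (ideator seat): nothing registered; `birth.lean` untouched.
REV2 (2026-08-29 ≈04Z): critic idea-crit-8 g4 V93 PASS-as-reduction, prices P1–P3 answered in the stub docstrings / card; S3 filled (p692885); S6 added (width); S5 narrowed.
REV3 (2026-08-29 ≈04:30Z): S2 `stub_chainRule` filled from ns-ezl-w1 g8 p694614 `…WeakChainRule.lean` (`WeakLagrangian.chainRule`); no statement text changed.
REV4 (2026-08-29 ≈05:2xZ): S6 `stub_supportLaw` filled from ns-ezl-w1 g8 p695120 `…WeakSupportLaw.lean` (`WeakLagrangian.supportLaw`); no statement text changed; the finite-volume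
kill is now a theorem MODULO its hypotheses S1 (`IsBackwardFlow`, M1 PORT) and S4 (`HasLagrangianKelvin`, M2 RESEARCH) — label of record N110-P4 unchanged; the wider
density-zero kill of the companion `Lines/weak_eulerian.lean` (E3, p698147) holds modulo E1 + E2 only.
REV5 (2026-08-29 ≈06:3xZ): COPY SYNC ONLY — `IsWeakConfinedCurl` re-copied VERBATIM from birth v107 (LEAD ns-typeII-p2 g15, 7fc1dcf104aa: alternative 4 «density-zero vorticity
support with renormalised vorticity» = line weak_eulerian E3 wired by name); no statement of this line changed otherwise; sorries 3 = S1/S4/S5.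
REV6 (2026-08-29 ≈07:5xZ, successor seat ns-idea-11 g10): COPY SYNC ONLY — `IsWeakConfinedCurl` re-copied VERBATIM from birth v110 (LEAD 0609e282b4cf8348: alternative 5
«weak axisymmetric swirl-free Casimir class» = line weak_axisym X2 `WeakAxisym.casimirRace` wired by name); no statement of this line changed; sorries 3 = S1/S4/S5.
REV7 (2026-08-29 ≈10:4xZ, ns-idea-11 g11): COPY SYNC ONLY (LEAD request nsreg 09:53:23Z) — `IsWeakConfinedCurl` re-copied VERBATIM from birth v112 (LEAD eb87ced7b2b1, sha16 2bb4b0975b5b60c0: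
alternative 5′ = the GEOMETRIC UY stratum of line `weak_axisym`, killed by tree theorems, whole member `WeakAxisym.axisymNoSwirl_trivial` p712169); no statement of this line changed
(identity vs birth v112: 9/9 shared blocks); sorries 3 = S1/S4/S5.
REV8 (2026-08-29 ≈11:5xZ, ns-idea-11 g11): COPY SYNC ONLY (LEAD request nsreg 11:31:24Z) — `IsWeakConfinedCurl` re-copied VERBATIM from birth v113 (LEAD ns-typeII-p2 g16, commit 0bbf31dfb2ac, sha16 95084b6b56e282cd, registered 11:31:24Z):
alternative 4′ = line `weak_eulerian` UNCONDITIONAL (∃ G, profile-gradient data ∧ div W = 3γ ∧ vorticity-support density → 0; birth branch BY NAME `WeakEulerian.weakVorticityEquation` →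
`WeakEulerian.renormalisation` → `WeakEulerian.supportDensityLaw`, no conditional E2 clause left), alternative 5′ = line `weak_axisym` (one name `WeakAxisym.axisymNoSwirl_trivial`); no statement of
THIS line changed (identity vs birth v113: 9/9 shared blocks byte-identical after whitespace normalisation); sorries 3 = S1/S4/S5.
WHAT THIS IS NOT: not NS regularity, not crux E, not the weak stub — a reduction of the weak stratum to «the needle wall off the finite-support stratum + three analytic
bricks (one research-level)».  No summit is proved by a line; 19832 OPEN.
REV9 (2026-08-29 ≈12:3xZ, ns-idea-11 g11): COPY SYNC ONLY (LEAD request nsreg 12:25:38Z) — `IsWeakConfinedCurl` re-copied VERBATIM from birth v115 (LEAD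
ns-typeII-p2 g16, commit 97807a79e132, sha16 282f55b374550410): alternative 5″ = the Ukhovskii–Yudovich weak axisymmetric swirl-free stratum about ANY AXIS
(`∃ R : E3 ≃ₗᵢ[ℝ] E3`, the alt-5′ clauses for `fun y => R (V (R.symm y))`; LEAD filler `WeakAxisym.axisymNoSwirl_trivial_anyAxis`, ns-ezl-w1 g10 p717759).  No statement of
THIS line changed (identity vs birth v115: 9/9 shared blocks); sorries unchanged.
-/

noncomputable section

open MeasureTheory Set Filter Topology Metric
open scoped ENNReal NNReal ContDiff

set_option linter.dupNamespace false
set_option maxSynthPendingDepth 3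

namespace Summit.NavierStokesRegularity.NavierStokesRegularity.Cruxes.PowerGaugeEulerLiouville.WeakLagrangian

open Summit.NavierStokesRegularity.NavierStokesRegularity.Theorems.PowerGaugeEulerLiouville.Birth

/-! ## The birth predicates (`E3`, `InClass`, …, `IsWeakConfinedCurl`) are IMPORTED since v117 from `Theorems/…BirthDefs{,Two,Three}.lean`
(namespace `…Theorems.PowerGaugeEulerLiouville.Birth`, opened above); only the target `Sig.stub_selfSimilarWeakRest` is still copied (it lives in `Lines/birth.lean`). -/

/-- VERBATIM birth v107 `Sig.stub_selfSimilarWeakRest` (the TARGET, by name-shape; text of v99 = v98 + `¬ IsWeakConfinedCurl ρ V`, unchanged in v100/v101). -/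
def Sig.stub_selfSimilarWeakRest : Prop :=
  ∀ ρ : ℝ, 0 < ρ → ρ ≤ 1 / 2 →
    ∀ (u : ℝ → E3 → E3) (p : ℝ → E3 → ℝ) (H : ℝ → E3 → E3 →L[ℝ] E3) (c : ℝ≥0) (V : E3 → E3) (P : E3 → ℝ),
      InClass ρ u p H c → IsExactlySelfSimilar ρ u p V P → IsExtremalProfile ρ V → ¬ ContDiff ℝ 2 V →
        ¬ IsHomogeneousProfile ρ V → ¬ (ρ = 1 / 2 ∧ IsPowerSpreadProfile V) → ¬ IsClassicalConcentrating ρ u p → ¬ IsWeakConfinedCurl ρ V →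
        Function.uncurry u =ᵐ[volume.restrict (Set.Iio (0 : ℝ) ×ˢ (Set.univ : Set E3))] 0

/-! ## The Lagrangian vocabulary of the weak stratum (line-local Props over tree notions) -/

/-- The similarity TRANSPORT FIELD `W = γy + V`, `γ = 1/(2+ρ)` (tree `selfSimilarTransport`, CIV (3.19)). -/
@[reducible] def transportW (ρ : ℝ) (V : E3 → E3) : E3 → E3 :=
  Literature.Analysis.FluidPDE.selfSimilarTransport (1 / (2 + ρ)) 0 V

/-- The similarity BERNOULLI FUNCTION `ℋ = P + ½|W|² − ½γ(1−γ)|y|²` (CIV (3.31); tree W-RN `WeakRenormalized`): `(W·∇)ℋ = −(1−2γ)|W|²` a.e. -/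
@[reducible] def bernoulliH (ρ : ℝ) (V : E3 → E3) (P : E3 → ℝ) : E3 → ℝ :=
  fun y => P y + (1 / 2) * ‖transportW ρ V y‖ ^ 2 - (1 / 2) * ((1 / (2 + ρ)) * (1 - 1 / (2 + ρ))) * ‖y‖ ^ 2

/-- The DIPERNA–LIONS DATA of the profile (conclusion shape of tree `WeakRenormalized.dipernaLionsData_of_selfSimilar`, p687484, minus (DL2)–(DL3) which the
stubs may re-derive): `G` is a whole-space weak gradient of `V`, `G ∈ L²_loc`, `V ∈ L⁶_loc`, and `W` has weak gradient `γ·id + G`. -/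
@[reducible] def IsProfileGradient (ρ : ℝ) (V : E3 → E3) (G : E3 → E3 →L[ℝ] E3) : Prop :=
  Literature.Analysis.FunctionSpaces.HasWeakFDerivOn (⊤ : TopologicalSpace.Opens E3) volume V G ∧
    (∀ r : ℝ, MemLp G 2 (volume.restrict (Metric.ball (0 : E3) r))) ∧
    (∀ r : ℝ, MemLp V 6 (volume.restrict (Metric.ball (0 : E3) r))) ∧
    Literature.Analysis.FunctionSpaces.HasWeakFDerivOn (⊤ : TopologicalSpace.Opens E3) volume (transportW ρ V)
      (fun x => (1 / (2 + ρ)) • ContinuousLinearMap.id ℝ E3 + G x)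

/-- `Ψ` is the BACKWARD REGULAR LAGRANGIAN FLOW of the member (the flow of `−W`, DiPerna–Lions / Ambrosio sense): jointly measurable, `Ψ₀ = id`, for a.e.
label `y` the curve `σ ↦ Ψ_σ y` is an integral curve of `−W` on `[0, ∞)` (integral form, hence absolutely continuous), the semigroup law holds a.e. for each
pair of times, and the EXACT JACOBIAN LAW `(Ψ_σ)_# vol = e^{3γσ} vol` (`div(−W) = −3γ`). -/
@[reducible] def IsBackwardFlow (ρ : ℝ) (V : E3 → E3) (Ψ : ℝ → E3 → E3) : Prop :=
  Measurable (Function.uncurry Ψ) ∧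
    (∀ y : E3, Ψ 0 y = y) ∧
    (∀ᵐ y ∂(volume : Measure E3), ∀ σ : ℝ, 0 ≤ σ →
      IntervalIntegrable (fun s => transportW ρ V (Ψ s y)) volume 0 σ ∧
        Ψ σ y = y - ∫ s in (0 : ℝ)..σ, transportW ρ V (Ψ s y)) ∧
    (∀ σ s : ℝ, 0 ≤ σ → 0 ≤ s → ∀ᵐ y ∂(volume : Measure E3), Ψ (σ + s) y = Ψ σ (Ψ s y)) ∧
    (∀ σ : ℝ, 0 ≤ σ →
      Measure.map (Ψ σ) (volume : Measure E3) = ENNReal.ofReal (Real.exp (3 * (1 / (2 + ρ)) * σ)) • (volume : Measure E3))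

/-- The LAGRANGIAN CHAIN RULE along the backward flow for Sobolev observables: every `f ∈ W^{1,1}_loc(ℝ³)` with weak gradient `g ∈ L^{3/2}_loc` satisfies, for
every `σ ≥ 0` and a.e. label, `f(Ψ_σ y) = f(y) − ∫₀^σ g(Ψ_s y)[W(Ψ_s y)] ds` («Lagrangian solutions = distributional solutions», the commutator-free case). -/
@[reducible] def HasChainRule (ρ : ℝ) (V : E3 → E3) (Ψ : ℝ → E3 → E3) : Prop :=
  ∀ (f : E3 → ℝ) (g : E3 → E3 →L[ℝ] ℝ),
    Literature.Analysis.FunctionSpaces.HasWeakFDerivOn (⊤ : TopologicalSpace.Opens E3) volume f g →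
    (∀ r : ℝ, MemLp g (3 / 2 : ℝ≥0∞) (volume.restrict (Metric.ball (0 : E3) r))) →
    ∀ σ : ℝ, 0 ≤ σ → ∀ᵐ y ∂(volume : Measure E3),
      IntervalIntegrable (fun s => g (Ψ s y) (transportW ρ V (Ψ s y))) volume 0 σ ∧
        f (Ψ σ y) = f y - ∫ s in (0 : ℝ)..σ, g (Ψ s y) (transportW ρ V (Ψ s y))

/-- The BERNOULLI CLOCK of the weak member: `ℋ` is non-decreasing along a.e. backward orbit (for each pair of times `0 ≤ σ₁ ≤ σ₂`, a.e. label). -/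
@[reducible] def HasBernoulliClock (ρ : ℝ) (V : E3 → E3) (P : E3 → ℝ) (Ψ : ℝ → E3 → E3) : Prop :=
  ∀ σ₁ σ₂ : ℝ, 0 ≤ σ₁ → σ₁ ≤ σ₂ → ∀ᵐ y ∂(volume : Measure E3),
    bernoulliH ρ V P (Ψ σ₁ y) ≤ bernoulliH ρ V P (Ψ σ₂ y)

/-- LAGRANGIAN KELVIN for the weak member: `D_σ(y)` solves the tangent system of `−W` along a.e. backward orbit, `D′ = −(γ·id + G(Ψ))∘D`, `D₀ = id` (the
derivative-in-measure of the flow, Le Bris–Lions), AND the CAUCHY FORMULA for the `L²_loc` vorticity `curl V = curlCLM ∘ G`: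
`curl V(Ψ_σ y) = e^{(1+γ)σ} D_σ(y) curl V(y)` for every `σ ≥ 0` and a.e. label (vorticity profile equation `(W·∇)Ω = (Ω·∇)W − (1+γ)Ω`). -/
@[reducible] def HasLagrangianKelvin (ρ : ℝ) (G : E3 → E3 →L[ℝ] E3) (Ψ : ℝ → E3 → E3)
    (D : ℝ → E3 → (E3 →L[ℝ] E3)) : Prop :=
  (∀ᵐ y ∂(volume : Measure E3), D 0 y = ContinuousLinearMap.id ℝ E3 ∧ ∀ σ : ℝ, 0 ≤ σ →
      IntervalIntegrable (fun s => ((1 / (2 + ρ)) • ContinuousLinearMap.id ℝ E3 + G (Ψ s y)).comp (D s y)) volume 0 σ ∧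
        D σ y = ContinuousLinearMap.id ℝ E3 -
          ∫ s in (0 : ℝ)..σ, ((1 / (2 + ρ)) • ContinuousLinearMap.id ℝ E3 + G (Ψ s y)).comp (D s y)) ∧
    (∀ σ : ℝ, 0 ≤ σ → ∀ᵐ y ∂(volume : Measure E3),
      Literature.Analysis.FluidPDE.curlCLM (G (Ψ σ y)) =
        Real.exp ((1 + 1 / (2 + ρ)) * σ) • D σ y (Literature.Analysis.FluidPDE.curlCLM (G y)))

/-! ## Stub signatures -/

/-- Signature of `stub_backwardFlow` (M1, PORT): a weak exactly self-similar class member in the window has a backward regular Lagrangian flow. -/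
def Sig.stub_backwardFlow : Prop :=
  ∀ ρ : ℝ, 0 < ρ → ρ ≤ 1 / 2 →
    ∀ (u : ℝ → E3 → E3) (p : ℝ → E3 → ℝ) (H : ℝ → E3 → E3 →L[ℝ] E3) (c : ℝ≥0) (V : E3 → E3) (P : E3 → ℝ)
      (G : E3 → E3 →L[ℝ] E3),
      InClass ρ u p H c → IsExactlySelfSimilar ρ u p V P → IsProfileGradient ρ V G →
        Integrable (fun y : E3 => ‖V y‖ ^ 2 / (1 + ‖y‖ ^ 2)) volume →
        ∃ Ψ : ℝ → E3 → E3, IsBackwardFlow ρ V Ψ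

/-- Signature of `stub_chainRule` (F2, FOLKLORE-L): the backward flow of a weak member transports Sobolev observables (chain rule a.e.). -/
def Sig.stub_chainRule : Prop :=
  ∀ ρ : ℝ, 0 < ρ → ρ ≤ 1 / 2 →
    ∀ (u : ℝ → E3 → E3) (p : ℝ → E3 → ℝ) (H : ℝ → E3 → E3 →L[ℝ] E3) (c : ℝ≥0) (V : E3 → E3) (P : E3 → ℝ)
      (G : E3 → E3 →L[ℝ] E3) (Ψ : ℝ → E3 → E3),
      InClass ρ u p H c → IsExactlySelfSimilar ρ u p V P → IsProfileGradient ρ V G → IsBackwardFlow ρ V Ψ →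
        HasChainRule ρ V Ψ

/-- Signature of `stub_bernoulliClock` (PROVABLE-M): chain rule + tree Lamb law ⇒ the Bernoulli clock. -/
def Sig.stub_bernoulliClock : Prop :=
  ∀ ρ : ℝ, 0 < ρ → ρ ≤ 1 / 2 →
    ∀ (u : ℝ → E3 → E3) (p : ℝ → E3 → ℝ) (H : ℝ → E3 → E3 →L[ℝ] E3) (c : ℝ≥0) (V : E3 → E3) (P : E3 → ℝ)
      (G : E3 → E3 →L[ℝ] E3) (Ψ : ℝ → E3 → E3),
      InClass ρ u p H c → IsExactlySelfSimilar ρ u p V P → IsProfileGradient ρ V G → IsBackwardFlow ρ V Ψ →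
        HasChainRule ρ V Ψ → HasBernoulliClock ρ V P Ψ

/-- Signature of `stub_lagrangianKelvin` (M2, RESEARCH): the backward flow of a weak member carries the tangent flow and the Cauchy formula. -/
def Sig.stub_lagrangianKelvin : Prop :=
  ∀ ρ : ℝ, 0 < ρ → ρ ≤ 1 / 2 →
    ∀ (u : ℝ → E3 → E3) (p : ℝ → E3 → ℝ) (H : ℝ → E3 → E3 →L[ℝ] E3) (c : ℝ≥0) (V : E3 → E3) (P : E3 → ℝ)
      (G : E3 → E3 →L[ℝ] E3) (Ψ : ℝ → E3 → E3),
      InClass ρ u p H c → IsExactlySelfSimilar ρ u p V P → IsProfileGradient ρ V G → IsBackwardFlow ρ V Ψ →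
        ∃ D : ℝ → E3 → (E3 →L[ℝ] E3), HasLagrangianKelvin ρ G Ψ D

/-- Signature of `stub_supportLaw` (REV2, PROVABLE-M — Chae's support law in the weak class): an exactly self-similar member whose profile gradient, backward flow and
Lagrangian Kelvin structure are given, and whose vorticity `curlCLM ∘ G` is supported on a set of FINITE VOLUME, is trivial (every `ρ ∈ (0,½]`). -/
def Sig.stub_supportLaw : Prop :=
  ∀ ρ : ℝ, 0 < ρ → ρ ≤ 1 / 2 →
    ∀ (u : ℝ → E3 → E3) (p : ℝ → E3 → ℝ) (H : ℝ → E3 → E3 →L[ℝ] E3) (c : ℝ≥0) (V : E3 → E3) (P : E3 → ℝ)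
      (G : E3 → E3 →L[ℝ] E3) (Ψ : ℝ → E3 → E3) (D : ℝ → E3 → (E3 →L[ℝ] E3)),
      InClass ρ u p H c → IsExactlySelfSimilar ρ u p V P → IsProfileGradient ρ V G → IsBackwardFlow ρ V Ψ →
        HasLagrangianKelvin ρ G Ψ D →
        (volume : Measure E3) {y : E3 | Literature.Analysis.FluidPDE.curlCLM (G y) ≠ 0} < ⊤ →
        Function.uncurry u =ᵐ[volume.restrict (Set.Iio (0 : ℝ) ×ˢ (Set.univ : Set E3))] 0

/-- Signature of `stub_weakNeedleFace` (OPEN — the needle wall in Lagrangian/a.e. binders, REV2: OFF THE FINITE-SUPPORT STRATUM): the weak-rest hypotheses plus the full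
Lagrangian portrait (backward RLF, chain rule, Bernoulli clock, Lagrangian Kelvin) plus INFINITE-VOLUME vorticity support force triviality. -/
def Sig.stub_weakNeedleFace : Prop :=
  ∀ ρ : ℝ, 0 < ρ → ρ ≤ 1 / 2 →
    ∀ (u : ℝ → E3 → E3) (p : ℝ → E3 → ℝ) (H : ℝ → E3 → E3 →L[ℝ] E3) (c : ℝ≥0) (V : E3 → E3) (P : E3 → ℝ)
      (G : E3 → E3 →L[ℝ] E3) (Ψ : ℝ → E3 → E3) (D : ℝ → E3 → (E3 →L[ℝ] E3)),
      InClass ρ u p H c → IsExactlySelfSimilar ρ u p V P → IsExtremalProfile ρ V → ¬ ContDiff ℝ 2 V →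
        ¬ IsHomogeneousProfile ρ V → ¬ (ρ = 1 / 2 ∧ IsPowerSpreadProfile V) → ¬ IsClassicalConcentrating ρ u p → ¬ IsWeakConfinedCurl ρ V →
        IsProfileGradient ρ V G → IsBackwardFlow ρ V Ψ → HasChainRule ρ V Ψ → HasBernoulliClock ρ V P Ψ →
        HasLagrangianKelvin ρ G Ψ D →
        (volume : Measure E3) {y : E3 | Literature.Analysis.FluidPDE.curlCLM (G y) ≠ 0} = ⊤ →
        Function.uncurry u =ᵐ[volume.restrict (Set.Iio (0 : ℝ) ×ˢ (Set.univ : Set E3))] 0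

/-! ## Registered stubs (genuine lemmas of the line; the ONLY placeholders of the file) -/

/-- M1 (PORT, XL in Lean): Ambrosio–Crippa 2008 Thm 26 [corpus:paper:doi-10-1007-978-3-540-76781-7-1 p.21–22] = DiPerna–Lions 1989 Thm III.1/III.2
[doi:10.1007/bf01393835] applied to the autonomous field `−W ∈ W^{1,2}_loc ⊂ W^{1,1}_loc`, `|W|/(1+|y|) ∈ L^∞ + L² ⊂ L¹ + L^∞` (i), `div(−W) = −3γ ∈ L^∞` (ii);
exact Jacobian by the comparison principle for the continuity equation (Ambrosio–Crippa 2008 Thm 23 p.19; the constant-in-space `e^{3γσ}` solves it). -/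
theorem stub_backwardFlow : Sig.stub_backwardFlow := by
  sorry

/-- F2 — FILLED in REV3 from ns-ezl-w1 g8 p694614 `Theorems/EulerZoomLiouvillePowerGaugeEulerLiouvilleWeakChainRule.lean`, theorem `WeakLagrangian.chainRule`
(bricks p693324 smooth observables along one AC curve, p693553 flow–Tonelli, p694137 Borel–Cantelli / mollification), cited BY NAME.  PLAN AS FILED (FOLKLORE-L): mollify `f`; classical chain rule along the absolutely continuous orbit; pass to the limit IN MEASURE on bounded label sets using the Jacobian law
and `g_ε → g` in `L^{3/2}_loc`, `W ∈ L⁶_loc ⊂ L³_loc` (no DiPerna–Lions commutator needed since `∇f` is a function).  ORBIT INTEGRABILITY (critic V93 P1 — the pairing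
that makes `g(Ψ_s y)[W(Ψ_s y)]` integrable along a.e. orbit): localise to the label sets `Y_M = {y : sup_{s ≤ σ} ‖Ψ_s y‖ ≤ M}` (a.e. label lies in some `Y_M`, the orbit
being continuous); by Tonelli and the Jacobian law `∫ h∘Ψ_s = e^{3γs} ∫ h`, `∫_{Y_M} ∫₀^σ |g(Ψ_s y)| |W(Ψ_s y)| ds dy ≤ σ e^{3γσ} ∫_{B_M} |g| |W| ≤ σ e^{3γσ}
‖g‖_{L^{3/2}(B_M)} ‖W‖_{L³(B_M)} < ∞` (`g ∈ L^{3/2}_loc`, `W ∈ L⁶_loc ⊂ L³_loc`), so the inner integral is finite for a.e. `y ∈ Y_M` (ns-ezl-w1 g8 HANDOFF plan (i)/(ii)). -/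
theorem stub_chainRule : Sig.stub_chainRule := by
  intro ρ hρ hρh u p H c V P G Ψ hcls hss hPG hΨ
  exact Summit.NavierStokesRegularity.NavierStokesRegularity.Theorems.PowerGaugeEulerLiouville.WeakLagrangian.chainRule
    hρ hρh hcls hss hPG hΨ

/-- FILLED (REV2): ns-ezl-w1 g8 p692885 `Theorems/EulerZoomLiouvillePowerGaugeEulerLiouvilleWeakBernoulliClock.lean`, theorem `WeakLagrangian.bernoulliClock` (the chain
rule for `f = ℋ` with the W-RN Lamb-form gradient, the pointwise identity `BG(W) = (2γ−1)‖W‖²`, transport to the label `Ψ_{σ₁} y` by the a.e. semigroup and the exact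
Jacobian law), stated with this line's reducible predicates δ-unfolded — cited BY NAME. -/
theorem stub_bernoulliClock : Sig.stub_bernoulliClock := by
  intro ρ hρ hρh u p H c V P G Ψ hcls hss hPG hΨ hCR
  exact Summit.NavierStokesRegularity.NavierStokesRegularity.Theorems.PowerGaugeEulerLiouville.WeakLagrangian.bernoulliClock
    hρ hρh hcls hss hPG hΨ hCR

/-- M2 (RESEARCH): tangent flow in print (Ambrosio–Crippa 2008 Thm 41 [corpus:… p.35–36] = Le Bris–Lions 2004 [doi:10.1007/s10231-003-0082-4]); the Cauchy formula for the
`L²_loc` vorticity of a `W^{1,2}_loc` Euler similarity profile is NOT in print (cotangent-lift renormalisation plausible; obstruction: unbounded stretching `DW ∈ L²`).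
THE EXACT WINDOW (critic V93 P3): for `W ∈ W^{1,p}_loc`, `p > 3`, `W` is continuous and the flow quasi-Lipschitz/`C¹`-in-measure arguments make the Cauchy formula classical
a.e.; the research content of this stub is precisely the class window `W^{1,2}_loc ∖ ⋃_{p>3} W^{1,p}_loc` (positive control: any `W^{1,p>3}` profile; falsifier: a
divergence-controlled `W ∈ W^{1,2}_loc` with two distinct `L²_loc` distributional solutions of the vector advection–stretching equation). -/
theorem stub_lagrangianKelvin : Sig.stub_lagrangianKelvin := by
  sorry

/-- REV2, PROVABLE-M — CHAE'S SUPPORT LAW IN THE WEAK CLASS (the `p → 0` endpoint of Chae 2007 Thm 1.1 / [corpus:paper:arxiv-math_0601661 p.3 Cor. 1] «`curl V ∈ L^p` for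
all small `p` ⇒ `V = 0`», whose classical proof transports `‖ω(t)‖_{L^p}` by a LIPSCHITZ back-to-labels map; the support endpoint needs none).  PROOF SKETCH: let
`S = {curlCLM ∘ G ≠ 0}` (a.e.-measurable: `G ∈ L²_loc`; replace by `toMeasurable`).  (1) FORWARD PROPAGATION OF IRROTATIONALITY: clause 2 of `HasLagrangianKelvin` reads
`curl V(Ψ_σ y) = e^{(1+γ)σ} D_σ(y)(curl V(y))` for a.e. `y`, so `curl V(y) = 0 ⇒ curl V(Ψ_σ y) = 0` — NO invertibility of `D_σ` is used — i.e. `Ψ_σ⁻¹ S ⊆ S` up to a null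
set.  (2) JACOBIAN: `vol(Ψ_σ⁻¹ S) = ((Ψ_σ)_# vol) S = e^{3γσ} vol S` (clause 5 of `IsBackwardFlow`, `Ψ_σ` measurable by clause 1).  (3) `e^{3γσ} vol S ≤ vol S < ∞` with
`σ = 1` forces `vol S = 0`: `curlCLM ∘ G = 0` a.e., so `G` is a.e. symmetric (`symm_of_curlCLM_eq_zero`, p692391 Tools) and trace-free (weak `div V = 0`,
`Past.profileData_of_past`), and the A-gauge growth `∫_{B_L}|V|² ≤ cL^{1−2ρ}`, `1−2ρ < 3`, gives `V = 0` a.e. by the tree's weak Liouville theorem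
`ae_eq_zero_of_symm_traceFree_of_growth` (…IrrotationalTools); hence `u = 0` a.e. on the slab.  Valid for EVERY `ρ ∈ (0,½]` — at `ρ = ½` the first kill of a weak profile.
FILLED (REV4): ns-ezl-w1 g8 p695120 `Theorems/EulerZoomLiouvillePowerGaugeEulerLiouvilleWeakSupportLaw.lean`, theorem `WeakLagrangian.supportLaw` (218 l., std axioms; the
sketch above, with `toMeasurable` and `Measure.map_apply`). -/
theorem stub_supportLaw : Sig.stub_supportLaw := by
  intro ρ hρ hρh u p H c V P G Ψ D hcls hss hPG hΨ hD hvol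
  exact Summit.NavierStokesRegularity.NavierStokesRegularity.Theorems.PowerGaugeEulerLiouville.WeakLagrangian.supportLaw
    hρ hρh hcls hss hPG hΨ hD hvol

/-- OPEN FACE — the needle wall of THE ONE STATEMENT in a.e. binders, OFF the finite-volume-vorticity-support stratum (REV2: hypothesis `vol{curlCLM ∘ G ≠ 0} = ∞`;
every `C²` kill that uses only the portrait ports verbatim; beyond `stub_supportLaw` no width is claimed here). -/
theorem stub_weakNeedleFace : Sig.stub_weakNeedleFace := by
  sorry

/-! ## Composition (kernel-checked, placeholder-free): the five stubs prove the birth target BY NAME -/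

/-- The DiPerna–Lions data of a weak member, from the tree certificate `WeakRenormalized.dipernaLionsData_of_selfSimilar` (p687484). -/
theorem profileGradient_of_member {ρ : ℝ} (hρ : 0 < ρ) (hρh : ρ ≤ 1 / 2)
    {u : ℝ → E3 → E3} {p : ℝ → E3 → ℝ} {H : ℝ → E3 → E3 →L[ℝ] E3} {c : ℝ≥0} {V : E3 → E3} {P : E3 → ℝ}
    (hcl : InClass ρ u p H c) (hss : IsExactlySelfSimilar ρ u p V P) :
    ∃ G : E3 → E3 →L[ℝ] E3, IsProfileGradient ρ V G ∧ Integrable (fun y : E3 => ‖V y‖ ^ 2 / (1 + ‖y‖ ^ 2)) volume := by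
  obtain ⟨hsw, hH, hgauge⟩ := hcl
  obtain ⟨hu, hp⟩ := hss
  obtain ⟨G, hVG, hG2, hV6, hWG, -, hint⟩ :=
    Summit.NavierStokesRegularity.NavierStokesRegularity.Theorems.PowerGaugeEulerLiouville.WeakRenormalized.dipernaLionsData_of_selfSimilar
      hρ hρh hsw hH hgauge hu hp
  exact ⟨G, ⟨hVG, hG2, hV6, hWG⟩, hint⟩

/-- **COMPOSITION (REV2).**  The four Lagrangian bricks, Chae's support law and the weak needle face prove `Sig.stub_selfSimilarWeakRest` (birth v107) BY NAME:
case split on the volume of the vorticity support `{curlCLM ∘ G ≠ 0}`. -/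
theorem selfSimilarWeakRest_of (h1 : Sig.stub_backwardFlow) (h2 : Sig.stub_chainRule) (h3 : Sig.stub_bernoulliClock)
    (h4 : Sig.stub_lagrangianKelvin) (h5 : Sig.stub_weakNeedleFace) (h6 : Sig.stub_supportLaw) : Sig.stub_selfSimilarWeakRest := by
  intro ρ hρ hρh u p H c V P hcl hss hext hC2 hhom hspread hconc hcurl
  obtain ⟨G, hG, hint⟩ := profileGradient_of_member hρ hρh hcl hss
  obtain ⟨Ψ, hΨ⟩ := h1 ρ hρ hρh u p H c V P G hcl hss hG hint
  have hcr : HasChainRule ρ V Ψ := h2 ρ hρ hρh u p H c V P G Ψ hcl hss hG hΨ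
  have hclock : HasBernoulliClock ρ V P Ψ := h3 ρ hρ hρh u p H c V P G Ψ hcl hss hG hΨ hcr
  obtain ⟨D, hD⟩ := h4 ρ hρ hρh u p H c V P G Ψ hcl hss hG hΨ
  by_cases hvol : (volume : Measure E3) {y : E3 | Literature.Analysis.FluidPDE.curlCLM (G y) ≠ 0} = ⊤
  · exact h5 ρ hρ hρh u p H c V P G Ψ D hcl hss hext hC2 hhom hspread hconc hcurl hG hΨ hcr hclock hD hvol
  · exact h6 ρ hρ hρh u p H c V P G Ψ D hcl hss hG hΨ hD (lt_top_iff_ne_top.mpr hvol)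

/-- The line's statement of record: the six stubs give the target. -/
theorem selfSimilarWeakRest : Sig.stub_selfSimilarWeakRest :=
  selfSimilarWeakRest_of stub_backwardFlow stub_chainRule stub_bernoulliClock stub_lagrangianKelvin stub_weakNeedleFace stub_supportLaw

/-! ## Sanity (placeholder-free): the vocabulary is not vacuous on the trivial member -/

/-- The transport field of the zero profile is the pure dilation `γy`. -/
theorem transportW_zero (ρ : ℝ) (y : E3) : transportW ρ (fun _ => 0) y = (1 / (2 + ρ)) • y := by
  simp [transportW, Literature.Analysis.FluidPDE.selfSimilarTransport]

end Summit.NavierStokesRegularity.NavierStokesRegularity.Cruxes.PowerGaugeEulerLiouville.WeakLagrangian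

end
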